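import Summits.Ventures.Crystal3D.Theorems.StickyWulffConstantPolycrystalWulffBoundTwinSectionShiftCubicTwin

/-!
# `PolycrystalWulffBound`, line `PolyDensity`: the twin section shift SLAB BY SLAB — in every horizontal
# slab the sections of `W` and of its twin along any normal `ν` are shifts of each other by at most
# `(2/√6)·|⟪e_k, ν⟫|` for each horizontal `⟨112⟩` direction `e_k` (crux `stmt-Ventures-19482`)

Route `StickyWulffConstant` of the venture `Summits/Ventures/Crystal3D`, second prover lane (poly-p2,
gen 9).  The chord flip of `…ChordFlip.lean` only needs two things of the body: every chord parallel to
`e` has its midpoint in the slab `|⟪x, e⟫| ≤ s₀` (two CAP conditions), and Cavalieri along the lines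
parallel to `e`.  Both survive intersecting the body with ANY measurable set `Z` invariant under
translations along `e` — e.g. a slab `{⟪x, m⟫ ∈ I}` of heights when `e ⊥ m`.  Hence
(`fccWulffBody_twin_slab_cdf_le₀/₁/₂`): for the cubic Wulff body `W`, its twin `R_{(1,1,1)} W`, every
measurable set `I ⊆ ℝ` of heights `⟪x, (1,1,1)⟫`, every `ν` and `t`, and each
`d_k ∈ {(−2,1,1), (1,−2,1), (1,1,−2)}`,

  `|R W ∩ {⟪x,(1,1,1)⟫ ∈ I} ∩ {⟪x,ν⟫ < t}| ≤ |W ∩ {⟪x,(1,1,1)⟫ ∈ I} ∩ {⟪x,ν⟫ < t + |⟪d_k, ν⟫|/3}|`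

(`|⟪d_k,ν⟫|/3 = (2/√6)·|⟪d_k/√6, ν⟫|`).  This is the kernel form of the slice-wise «SectionShift»
input of the m-first zone engine planned in poly-p2 g8's memo P-TWIN-g8 §1/§5 (level-2 charge
`X(τ, θ_w) ≤ (2/√6)·sin θ_w ≤ 1/√6`, uniformly in the height `τ`): the twin body is an
`e_k`-displacement rearrangement of `W` with sup-displacement `2/√6` (seat memo P-TWIN-g9 §2).
* `volume_inter_lt_reflect_le_of_caps` — the chord flip with two cap conditions (no central symmetry)
  and an `e`-invariant measurable restriction `Z`;
* `fccWulffBody_twin_slab_cdf_le_of_zone` — the slab statement from zone data, and the three zones.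
WHAT THIS IS NOT: the zone-with-loss engine itself; the crux-vocabulary transport (next file); the crux
is not claimed. -/

noncomputable section

open scoped BigOperators InnerProductSpace ENNReal
open MeasureTheory Set

namespace Summit.Ventures.Crystal3D.Theorems

open Summit.Ventures.Crystal3D.Cruxes.TextureLiminf.TexShadow (E3)
open Literature.MathematicalPhysics.StatisticalMechanics (fccWulffBody mem_fccWulffBody_iff
  isCompact_fccWulffBody convex_fccWulffBody)

/-! ### The chord flip with caps and an invariant restriction -/

/-- **Chord flip, restricted form.**  `K` compact convex, `e` a unit vector, `s₀` a level such that both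
caps `K ∩ {⟪x,e⟫ ≥ s₀}` and `K ∩ {⟪x,e⟫ ≤ −s₀}` reflect into `K` across their base planes, and `Z` a
measurable set invariant under translations along `e`.  Then for every `ν`, `t` and
`δ ≥ 2 s₀ |⟪e, ν⟫|`:  `|K ∩ Z ∩ {⟪x, ν − 2⟪e,ν⟫e⟫ < t}| ≤ |K ∩ Z ∩ {⟪x, ν⟫ < t + δ}|`. -/
theorem volume_inter_lt_reflect_le_of_caps {K Z : Set E3} (hKc : Convex ℝ K) (hK : IsCompact K)
    (hZ : MeasurableSet Z) {e : E3} (hZe : ∀ x ∈ Z, ∀ s : ℝ, x + s • e ∈ Z) (he : ‖e‖ = 1) {s₀ : ℝ}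
    (hcap : ∀ x ∈ K, s₀ ≤ ⟪x, e⟫_ℝ → x - (2 * (⟪x, e⟫_ℝ - s₀)) • e ∈ K)
    (hcap' : ∀ x ∈ K, ⟪x, e⟫_ℝ ≤ -s₀ → x - (2 * (⟪x, e⟫_ℝ + s₀)) • e ∈ K)
    (ν : E3) (t : ℝ) {δ : ℝ} (hδ : 2 * s₀ * |⟪e, ν⟫_ℝ| ≤ δ) :
    volume (K ∩ Z ∩ {x : E3 | ⟪x, ν - (2 * ⟪e, ν⟫_ℝ) • e⟫_ℝ < t}) ≤
      volume (K ∩ Z ∩ {x : E3 | ⟪x, ν⟫_ℝ < t + δ}) := by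
  obtain ⟨U, V, hU, hV, hUV, heU, heV⟩ := Literature.Analysis.Convexity.exists_orthonormal_pair_perp e
  have hKm : MeasurableSet K := hK.isClosed.measurableSet
  have hcont : ∀ μ : E3, Continuous fun x : E3 => ⟪x, μ⟫_ℝ := fun μ =>
    continuous_id.inner continuous_const
  have hLm : MeasurableSet (K ∩ Z ∩ {x : E3 | ⟪x, ν - (2 * ⟪e, ν⟫_ℝ) • e⟫_ℝ < t}) :=
    (hKm.inter hZ).inter (isOpen_lt (hcont _) continuous_const).measurableSet
  have hRm : MeasurableSet (K ∩ Z ∩ {x : E3 | ⟪x, ν⟫_ℝ < t + δ}) :=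
    (hKm.inter hZ).inter (isOpen_lt (hcont _) continuous_const).measurableSet
  rw [volume_eq_lintegral_volume_lineSection he hU hV hUV heU heV hLm,
    volume_eq_lintegral_volume_lineSection he hU hV hUV heU heV hRm]
  refine lintegral_mono fun y => ?_
  have hee : ⟪e, e⟫_ℝ = 1 := by rw [real_inner_self_eq_norm_sq, he, one_pow]
  have hUe : ⟪U, e⟫_ℝ = 0 := by rw [real_inner_comm]; exact heU
  have hVe : ⟪V, e⟫_ℝ = 0 := by rw [real_inner_comm]; exact heV
  have hxe : ∀ s : ℝ, ⟪s • e + y.1 • U + y.2 • V, e⟫_ℝ = s := by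
    intro s
    rw [inner_add_left, inner_add_left, real_inner_smul_left, real_inner_smul_left,
      real_inner_smul_left, hee, hUe, hVe]
    ring
  have hxν : ∀ s : ℝ, ⟪s • e + y.1 • U + y.2 • V, ν⟫_ℝ =
      s * ⟪e, ν⟫_ℝ + (y.1 * ⟪U, ν⟫_ℝ + y.2 * ⟪V, ν⟫_ℝ) := by
    intro s
    rw [inner_add_left, inner_add_left, real_inner_smul_left, real_inner_smul_left,
      real_inner_smul_left]
    ring
  have hxRν : ∀ s : ℝ, ⟪s • e + y.1 • U + y.2 • V, ν - (2 * ⟪e, ν⟫_ℝ) • e⟫_ℝ =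
      (y.1 * ⟪U, ν⟫_ℝ + y.2 * ⟪V, ν⟫_ℝ) - s * ⟪e, ν⟫_ℝ := by
    intro s
    rw [inner_sub_right, real_inner_smul_right, hxν, hxe]
    ring
  -- membership in `Z` is constant along the line
  have hZline : ∀ s : ℝ, s • e + y.1 • U + y.2 • V ∈ Z ↔ y.1 • U + y.2 • V ∈ Z := by
    intro s
    constructor
    · intro h
      have h' := hZe _ h (-s)
      have heq : s • e + y.1 • U + y.2 • V + (-s) • e = y.1 • U + y.2 • V := by module
      rwa [heq] at h'
    · intro h
      have h' := hZe _ h s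
      have heq : y.1 • U + y.2 • V + s • e = s • e + y.1 • U + y.2 • V := by module
      rwa [heq] at h'
  set κ : ℝ := ⟪e, ν⟫_ℝ with hκ
  set β : ℝ := y.1 * ⟪U, ν⟫_ℝ + y.2 * ⟪V, ν⟫_ℝ with hβ
  by_cases hyZ : y.1 • U + y.2 • V ∈ Z
  · have hL : {s : ℝ | s • e + y.1 • U + y.2 • V ∈ K ∩ Z ∩ {x : E3 | ⟪x, ν - (2 * κ) • e⟫_ℝ < t}} =
        {s : ℝ | s • e + y.1 • U + y.2 • V ∈ K ∧ β - s * κ < t} := by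
      ext s
      simp only [mem_setOf_eq, mem_inter_iff, hxRν, hZline, hyZ, and_true]
    have hR : {s : ℝ | s • e + y.1 • U + y.2 • V ∈ K ∩ Z ∩ {x : E3 | ⟪x, ν⟫_ℝ < t + δ}} =
        {s : ℝ | s • e + y.1 • U + y.2 • V ∈ K ∧ s * κ + β < t + δ} := by
      ext s
      simp only [mem_setOf_eq, mem_inter_iff, hxν, hZline, hyZ, and_true]
    rw [hL, hR]
    by_cases hne : {s : ℝ | s • e + y.1 • U + y.2 • V ∈ K}.Nonempty
    · obtain ⟨lo, hi, hC, hlohi⟩ := lineSection_eq_Icc hKc hK he U V y hne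
      have hmemC : ∀ s : ℝ, s • e + y.1 • U + y.2 • V ∈ K ↔ s ∈ Icc lo hi := fun s => by
        rw [← hC]; rfl
      have hup : lo + hi ≤ 2 * s₀ := by
        by_cases hhi : s₀ ≤ hi
        · have hhiK : hi • e + y.1 • U + y.2 • V ∈ K := (hmemC hi).2 ⟨hlohi, le_rfl⟩
          have h := hcap _ hhiK (by rw [hxe]; exact hhi)
          rw [hxe] at h
          have heq : hi • e + y.1 • U + y.2 • V - (2 * (hi - s₀)) • e =
              (2 * s₀ - hi) • e + y.1 • U + y.2 • V := by module
          rw [heq, hmemC] at h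
          linarith [h.1]
        · have hhi' : hi < s₀ := lt_of_not_ge hhi
          linarith
      have hdown : -(2 * s₀) ≤ lo + hi := by
        by_cases hlo : lo ≤ -s₀
        · have hloK : lo • e + y.1 • U + y.2 • V ∈ K := (hmemC lo).2 ⟨le_rfl, hlohi⟩
          have h := hcap' _ hloK (by rw [hxe]; exact hlo)
          rw [hxe] at h
          have heq : lo • e + y.1 • U + y.2 • V - (2 * (lo + s₀)) • e =
              (-lo - 2 * s₀) • e + y.1 • U + y.2 • V := by module
          rw [heq, hmemC] at h
          linarith [h.2]
        · have hlo' : -s₀ < lo := lt_of_not_ge hlo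
          linarith
      have habs : |lo + hi| ≤ 2 * s₀ := abs_le.2 ⟨hdown, hup⟩
      have hRm1 : MeasurableSet {s : ℝ | s • e + y.1 • U + y.2 • V ∈ K ∧ s * κ + β < t + δ} := by
        have h1 : MeasurableSet {s : ℝ | s • e + y.1 • U + y.2 • V ∈ K} := by
          rw [hC]; exact measurableSet_Icc
        have h2 : MeasurableSet {s : ℝ | s * κ + β < t + δ} :=
          (isOpen_lt (by fun_prop) continuous_const).measurableSet
        exact h1.inter h2
      refine volume_le_volume_of_sub_mem (lo + hi) hRm1 fun s hs => ?_
      obtain ⟨hsK, hst⟩ := hs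
      have hsC : s ∈ Icc lo hi := (hmemC s).1 hsK
      refine ⟨(hmemC _).2 ⟨by linarith [hsC.2], by linarith [hsC.1]⟩, ?_⟩
      have h1 : (lo + hi) * κ ≤ |lo + hi| * |κ| := by rw [← abs_mul]; exact le_abs_self _
      have h2 : |lo + hi| * |κ| ≤ 2 * s₀ * |κ| := mul_le_mul_of_nonneg_right habs (abs_nonneg _)
      have h3 : (lo + hi - s) * κ + β = (lo + hi) * κ + (β - s * κ) := by ring
      rw [h3]
      linarith
    · have h0 : {s : ℝ | s • e + y.1 • U + y.2 • V ∈ K ∧ β - s * κ < t} = ∅ := by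
        ext s
        simp only [mem_setOf_eq, mem_empty_iff_false, iff_false, not_and]
        intro hs
        exact absurd ⟨s, hs⟩ hne
      rw [h0, measure_empty]
      exact bot_le
  · have h0 : {s : ℝ | s • e + y.1 • U + y.2 • V ∈ K ∩ Z ∩ {x : E3 | ⟪x, ν - (2 * κ) • e⟫_ℝ < t}} = ∅ := by
      ext s
      simp only [mem_setOf_eq, mem_inter_iff, mem_empty_iff_false, iff_false]
      rintro ⟨⟨-, hz⟩, -⟩
      exact hyZ ((hZline s).1 hz)
    rw [h0, measure_empty]
    exact bot_le

/-- The restricted chord flip for a non-normalised mirror direction `d` (`‖d‖² = N`), caps at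
`⟪x, d⟫ = ±ℓ`, shift `2ℓ|⟪d,ν⟫|/N`. -/
theorem volume_inter_lt_reflect_le_of_caps_div {K Z : Set E3} (hKc : Convex ℝ K) (hK : IsCompact K)
    (hZ : MeasurableSet Z) {d : E3} (hZd : ∀ x ∈ Z, ∀ s : ℝ, x + s • d ∈ Z) {N : ℝ} (hN : ‖d‖ ^ 2 = N)
    (hN0 : 0 < N) {ℓ : ℝ}
    (hcap : ∀ x ∈ K, ℓ ≤ ⟪x, d⟫_ℝ → x - (2 * (⟪x, d⟫_ℝ - ℓ) / N) • d ∈ K)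
    (hcap' : ∀ x ∈ K, ⟪x, d⟫_ℝ ≤ -ℓ → x - (2 * (⟪x, d⟫_ℝ + ℓ) / N) • d ∈ K)
    (ν : E3) (t : ℝ) {δ : ℝ} (hδ : 2 * ℓ * |⟪d, ν⟫_ℝ| / N ≤ δ) :
    volume (K ∩ Z ∩ {x : E3 | ⟪x, ν - (2 * ⟪d, ν⟫_ℝ / N) • d⟫_ℝ < t}) ≤
      volume (K ∩ Z ∩ {x : E3 | ⟪x, ν⟫_ℝ < t + δ}) := by
  have hr : 0 < ‖d‖ := by
    rcases (norm_nonneg d).eq_or_lt with h | h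
    · exfalso
      rw [← h] at hN
      rw [← hN] at hN0
      norm_num at hN0
    · exact h
  set r := ‖d‖ with hr_def
  have hrN : r * r = N := by rw [← hN, sq]
  set e : E3 := r⁻¹ • d with he_def
  have he : ‖e‖ = 1 := by
    rw [he_def, norm_smul, Real.norm_eq_abs, abs_inv, abs_of_pos hr, inv_mul_cancel₀ hr.ne']
  have hinner_e : ∀ y : E3, ⟪y, e⟫_ℝ = r⁻¹ * ⟪y, d⟫_ℝ := fun y => by
    rw [he_def, real_inner_smul_right]
  have hinner_e' : ∀ y : E3, ⟪e, y⟫_ℝ = r⁻¹ * ⟪d, y⟫_ℝ := fun y => by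
    rw [he_def, real_inner_smul_left]
  have hZe : ∀ x ∈ Z, ∀ s : ℝ, x + s • e ∈ Z := by
    intro x hx s
    rw [he_def, smul_smul]
    exact hZd x hx _
  have hcapE : ∀ x ∈ K, ℓ / r ≤ ⟪x, e⟫_ℝ → x - (2 * (⟪x, e⟫_ℝ - ℓ / r)) • e ∈ K := by
    intro x hx hxe
    rw [hinner_e] at hxe
    have hℓ : ℓ ≤ ⟪x, d⟫_ℝ := by
      have h := mul_le_mul_of_nonneg_left hxe hr.le
      rwa [mul_div_cancel₀ _ hr.ne', ← mul_assoc, mul_inv_cancel₀ hr.ne', one_mul] at h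
    have h := hcap x hx hℓ
    have heq : x - (2 * (⟪x, e⟫_ℝ - ℓ / r)) • e = x - (2 * (⟪x, d⟫_ℝ - ℓ) / N) • d := by
      rw [hinner_e, he_def, smul_smul, ← hrN]
      congr 2
      field_simp
    rw [heq]
    exact h
  have hcapE' : ∀ x ∈ K, ⟪x, e⟫_ℝ ≤ -(ℓ / r) → x - (2 * (⟪x, e⟫_ℝ + ℓ / r)) • e ∈ K := by
    intro x hx hxe
    rw [hinner_e] at hxe
    have hℓ : ⟪x, d⟫_ℝ ≤ -ℓ := by
      have h := mul_le_mul_of_nonneg_left hxe hr.le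
      rwa [mul_neg, mul_div_cancel₀ _ hr.ne', ← mul_assoc, mul_inv_cancel₀ hr.ne', one_mul] at h
    have h := hcap' x hx hℓ
    have heq : x - (2 * (⟪x, e⟫_ℝ + ℓ / r)) • e = x - (2 * (⟪x, d⟫_ℝ + ℓ) / N) • d := by
      rw [hinner_e, he_def, smul_smul, ← hrN]
      congr 2
      field_simp
    rw [heq]
    exact h
  have hδ' : 2 * (ℓ / r) * |⟪e, ν⟫_ℝ| ≤ δ := by
    rw [hinner_e', abs_mul, abs_inv, abs_of_pos hr]
    have h : 2 * (ℓ / r) * (r⁻¹ * |⟪d, ν⟫_ℝ|) = 2 * ℓ * |⟪d, ν⟫_ℝ| / N := by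
      rw [← hrN]
      field_simp
    rw [h]
    exact hδ
  have h := volume_inter_lt_reflect_le_of_caps hKc hK hZ hZe he hcapE hcapE' ν t hδ'
  have hvec : ν - (2 * ⟪e, ν⟫_ℝ) • e = ν - (2 * ⟪d, ν⟫_ℝ / N) • d := by
    rw [hinner_e', he_def, smul_smul, ← hrN]
    congr 2
    field_simp
  rw [hvec] at h
  exact h

/-! ### The lower caps of the truncated octahedron -/

/-- The lower cap condition at `⟪x, d_k⟫ = −1` follows from the upper one and `W = −W`. -/
theorem cap_reflect_mem_fccWulffBody_neg {d : E3}
    (hcap : ∀ x ∈ fccWulffBody, 1 ≤ ⟪x, d⟫_ℝ → x - (2 * (⟪x, d⟫_ℝ - 1) / 6) • d ∈ fccWulffBody)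
    {x : E3} (hx : x ∈ fccWulffBody) (h1 : ⟪x, d⟫_ℝ ≤ -1) :
    x - (2 * (⟪x, d⟫_ℝ + 1) / 6) • d ∈ fccWulffBody := by
  have hnx : -x ∈ fccWulffBody := neg_mem_fccWulffBody hx
  have h := hcap (-x) hnx (by rw [inner_neg_left]; linarith)
  have h' := neg_mem_fccWulffBody h
  have heq : -(-x - (2 * (⟪-x, d⟫_ℝ - 1) / 6) • d) = x - (2 * (⟪x, d⟫_ℝ + 1) / 6) • d := by
    rw [inner_neg_left]
    have hc : 2 * (-⟪x, d⟫_ℝ - 1) / 6 = -(2 * (⟪x, d⟫_ℝ + 1) / 6) := by ring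
    rw [hc, neg_smul]
    abel
  rw [heq] at h'
  exact h'

/-! ### The slab statement -/

/-- **Twin section shift slab by slab, from zone data.**  For a zone vector `d_k` (`‖d_k‖² = 6`, cap
condition, the twin identity with the swap mirror `σ`, `σ` preserving `W` and the heights) every height
slab `Z = {⟪x,(1,1,1)⟫ ∈ I}` satisfies
`|R W ∩ Z ∩ {⟪x,ν⟫ < t}| ≤ |W ∩ Z ∩ {⟪x,ν⟫ < t + |⟪d_k, ν⟫|/3}|`. -/
theorem fccWulffBody_twin_slab_cdf_le_of_zone (dk v : E3) (hN : ‖dk‖ ^ 2 = 6)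
    (hdk : ⟪dk, (!₂[(1 : ℝ), 1, 1] : E3)⟫_ℝ = 0)
    (hcap : ∀ x ∈ fccWulffBody, 1 ≤ ⟪x, dk⟫_ℝ → x - (2 * (⟪x, dk⟫_ℝ - 1) / 6) • dk ∈ fccWulffBody)
    (hσW : (ℝ ∙ v)ᗮ.reflection '' (fccWulffBody : Set E3) = fccWulffBody)
    (hσd : (ℝ ∙ v)ᗮ.reflection (!₂[(1 : ℝ), 1, 1] : E3) = !₂[(1 : ℝ), 1, 1])
    (hid : ∀ n : E3, -((ℝ ∙ (!₂[(1 : ℝ), 1, 1] : E3))ᗮ.reflection n) =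
      (ℝ ∙ v)ᗮ.reflection n - (2 * ⟪dk, (ℝ ∙ v)ᗮ.reflection n⟫_ℝ / 6) • dk)
    (hin : ∀ n : E3, ⟪dk, (ℝ ∙ v)ᗮ.reflection n⟫_ℝ = ⟪dk, n⟫_ℝ)
    {I : Set ℝ} (hI : MeasurableSet I) (ν : E3) (t : ℝ) :
    volume ((ℝ ∙ (!₂[(1 : ℝ), 1, 1] : E3))ᗮ.reflection '' fccWulffBody ∩
        {x : E3 | ⟪x, (!₂[(1 : ℝ), 1, 1] : E3)⟫_ℝ ∈ I} ∩ {x : E3 | ⟪x, ν⟫_ℝ < t}) ≤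
      volume (fccWulffBody ∩ {x : E3 | ⟪x, (!₂[(1 : ℝ), 1, 1] : E3)⟫_ℝ ∈ I} ∩
        {x : E3 | ⟪x, ν⟫_ℝ < t + |⟪dk, ν⟫_ℝ| / 3}) := by
  set d : E3 := !₂[(1 : ℝ), 1, 1] with hd
  set R := (ℝ ∙ d)ᗮ.reflection with hR
  set σ := (ℝ ∙ v)ᗮ.reflection with hσ
  have hWm : MeasurableSet (fccWulffBody : Set E3) := isCompact_fccWulffBody.measurableSet
  have hcont : ∀ μ : E3, Continuous fun x : E3 => ⟪x, μ⟫_ℝ := fun μ =>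
    continuous_id.inner continuous_const
  have hZm : ∀ J : Set ℝ, MeasurableSet J → MeasurableSet {x : E3 | ⟪x, d⟫_ℝ ∈ J} := fun J hJ =>
    hJ.preimage (hcont d).measurable
  -- the twin mirror negates the height, `−1` negates it back
  have hRd : ∀ x : E3, ⟪R x, d⟫_ℝ = -⟪x, d⟫_ℝ := by
    intro x
    rw [hR, reflection_orthogonal_apply_div, inner_sub_left, real_inner_smul_left,
      real_inner_self_eq_norm_sq, norm_sq_cubic_vectors.1, real_inner_comm]
    ring
  have hRZ : R '' (fccWulffBody ∩ {x : E3 | ⟪x, d⟫_ℝ ∈ -I}) =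
      R '' fccWulffBody ∩ {x : E3 | ⟪x, d⟫_ℝ ∈ I} := by
    ext y
    constructor
    · rintro ⟨x, ⟨hx, hxI⟩, rfl⟩
      refine ⟨⟨x, hx, rfl⟩, ?_⟩
      show ⟪R x, d⟫_ℝ ∈ I
      rw [hRd]
      simpa using hxI
    · rintro ⟨⟨x, hx, rfl⟩, hyI⟩
      refine ⟨x, ⟨hx, ?_⟩, rfl⟩
      have h : ⟪R x, d⟫_ℝ ∈ I := hyI
      rw [hRd] at h
      show ⟪x, d⟫_ℝ ∈ -I
      simpa using h
  have h1 : volume (R '' fccWulffBody ∩ {x : E3 | ⟪x, d⟫_ℝ ∈ I} ∩ {x : E3 | ⟪x, ν⟫_ℝ < t}) =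
      volume (fccWulffBody ∩ {x : E3 | ⟪x, d⟫_ℝ ∈ -I} ∩ {x : E3 | ⟪x, R ν⟫_ℝ < t}) := by
    rw [← hRZ, volume_image_inter_halfSpace R (hWm.inter (hZm _ hI.neg)) ν t, hR,
      Submodule.reflection_symm]
  have hnegZ : (LinearIsometryEquiv.neg ℝ : E3 ≃ₗᵢ[ℝ] E3) '' (fccWulffBody ∩ {x : E3 | ⟪x, d⟫_ℝ ∈ I}) =
      fccWulffBody ∩ {x : E3 | ⟪x, d⟫_ℝ ∈ -I} := by
    ext y
    constructor
    · rintro ⟨x, ⟨hx, hxI⟩, rfl⟩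
      refine ⟨neg_mem_fccWulffBody hx, ?_⟩
      show ⟪-x, d⟫_ℝ ∈ -I
      rw [inner_neg_left]
      simpa using hxI
    · rintro ⟨hy, hyI⟩
      refine ⟨-y, ⟨neg_mem_fccWulffBody hy, ?_⟩, neg_neg y⟩
      have h : ⟪y, d⟫_ℝ ∈ -I := hyI
      show ⟪-y, d⟫_ℝ ∈ I
      rw [inner_neg_left]
      simpa using h
  have h2 : volume (fccWulffBody ∩ {x : E3 | ⟪x, d⟫_ℝ ∈ -I} ∩ {x : E3 | ⟪x, R ν⟫_ℝ < t}) =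
      volume (fccWulffBody ∩ {x : E3 | ⟪x, d⟫_ℝ ∈ I} ∩ {x : E3 | ⟪x, -(R ν)⟫_ℝ < t}) := by
    rw [← hnegZ, volume_image_inter_halfSpace (LinearIsometryEquiv.neg ℝ : E3 ≃ₗᵢ[ℝ] E3)
      (hWm.inter (hZm _ hI)) (R ν) t]
    rfl
  rw [h1, h2, hid ν]
  -- the chord flip along `dk`, restricted to the slab
  have hZd : ∀ x ∈ {x : E3 | ⟪x, d⟫_ℝ ∈ I}, ∀ s : ℝ, x + s • dk ∈ {x : E3 | ⟪x, d⟫_ℝ ∈ I} := by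
    intro x hx s
    show ⟪x + s • dk, d⟫_ℝ ∈ I
    rw [inner_add_left, real_inner_smul_left, hdk, mul_zero, add_zero]
    exact hx
  have hδ : 2 * 1 * |⟪dk, σ ν⟫_ℝ| / 6 ≤ |⟪dk, ν⟫_ℝ| / 3 := by rw [hin]; linarith [abs_nonneg ⟪dk, ν⟫_ℝ]
  have h := volume_inter_lt_reflect_le_of_caps_div convex_fccWulffBody isCompact_fccWulffBody (hZm _ hI)
    hZd hN (by norm_num) hcap (fun x hx hx1 => cap_reflect_mem_fccWulffBody_neg hcap hx hx1) (σ ν) t hδ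
  -- `σ` preserves `W` and the slab
  have hσZ : σ '' (fccWulffBody ∩ {x : E3 | ⟪x, d⟫_ℝ ∈ I}) = fccWulffBody ∩ {x : E3 | ⟪x, d⟫_ℝ ∈ I} := by
    have hσx : ∀ x : E3, ⟪σ x, d⟫_ℝ = ⟪x, d⟫_ℝ := by
      intro x
      conv_lhs => rw [← hσd]
      exact LinearIsometryEquiv.inner_map_map σ x d
    ext y
    constructor
    · rintro ⟨x, ⟨hx, hxI⟩, rfl⟩
      refine ⟨?_, ?_⟩
      · rw [← hσW]; exact ⟨x, hx, rfl⟩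
      · show ⟪σ x, d⟫_ℝ ∈ I
        rw [hσx]; exact hxI
    · rintro ⟨hy, hyI⟩
      refine ⟨σ y, ⟨?_, ?_⟩, Submodule.reflection_reflection _ y⟩
      · rw [← hσW]; exact ⟨y, hy, rfl⟩
      · have h : ⟪y, d⟫_ℝ ∈ I := hyI
        show ⟪σ y, d⟫_ℝ ∈ I
        rw [hσx]; exact h
  have hσvol : volume (fccWulffBody ∩ {x : E3 | ⟪x, d⟫_ℝ ∈ I} ∩ {x : E3 | ⟪x, σ ν⟫_ℝ < t + |⟪dk, ν⟫_ℝ| / 3}) =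
      volume (fccWulffBody ∩ {x : E3 | ⟪x, d⟫_ℝ ∈ I} ∩ {x : E3 | ⟪x, ν⟫_ℝ < t + |⟪dk, ν⟫_ℝ| / 3}) := by
    have h' := volume_image_inter_halfSpace σ (hWm.inter (hZm _ hI)) (σ ν) (t + |⟪dk, ν⟫_ℝ| / 3)
    rw [hσZ, hσ, Submodule.reflection_symm, Submodule.reflection_reflection] at h'
    exact h'
  rw [hσvol] at h
  exact h

end Summit.Ventures.Crystal3D.Theorems

end
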